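import Summits.QuantumFields.BalabanUV.T4Continuum.Support.ScalarBlockTrialFunction
import Literature.MathematicalPhysics.QuantumFieldTheory.Balaban1983to89.Beta.CoordCubePoincare

/-!
# T⁴ programme, spine node NE2 (U1a), road P2 supplier item (O6)(a) — THE IN-BLOCK POINCARÉ INEQUALITY FOR 0-FORMS:
# `‖f − Π′f‖² ≤ ((n−1)/(2n))·Σ_ν Σ_{bonds INSIDE a block} |∂_ν f|²`, `Π′ = n^d·Q′ᴴQ′`, with a `d`-FREE constant `≤ ½`

NE2 formalisation swarm `b2b-balaban-t4-ne2-formalise-*`, leaf prover 01 (gen 4), answering the road owner t4-ne2-p2-g11's OPEN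
SUPPLIER ITEM (O6)(a) «P⁺-LOCAL» (CLAIMS.log l.10301): today leaf P⁺ (`VariationalCovariantPoincare.nsq_le_covariant_poincare`)
frames the field GLOBALLY because the `U = 1` block Poincaré inequality it transports, `ScalarBlockPoincare.nsq_sub_PiS_le`
(`nsq (f − Π′f) ≤ 4d·Σ_ν nsq (∂_ν f)`, row B4.c), is proved with the MOVING box average and therefore charges EVERY bond of the
torus, including the bonds that cross a block face.  Coercivity of `1 − Π′` is block-local in truth; this file proves it:

 * §1 `sum_norm_sub_mean_sq_le_cube` — the discrete Poincaré inequality on the coordinate cube `Fin d → Fin (n+1)` for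
   COMPLEX-valued functions, `Σ_y ‖F y − mean F‖² ≤ (n(n+1)/2)·Σ_μ Σ_{y : y μ ≠ last} ‖F (y + e_μ) − F y‖²`, read off the β
   sub-cell's REAL kernel theorem `Beta.CoordCubePoincare.poincare_coordCube` (p179652; tensorisation of the path inequality with
   the `d`-INDEPENDENT constant — Bakry–Gentil–Ledoux Prop. 4.3.1 shape) applied to `re ∘ F` and `im ∘ F`;
 * §2 the torus instance, block by block along the digit chart `(y, j) ↦ bpt n M y j = n·y + j` of [B5] (1.6)
   (`B5Blocks16.bpt_bijective`): `nsq_sub_PiS_eq_sum_blocks` (`nsq (f − Π′f) = Σ_y Σ_j ‖f(n·y + j) − (Q′f)(y)‖²`), the per-block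
   inequality `sum_block_norm_sub_mean_sq_le`, and the END
   **`nsq_sub_PiS_le_inBlock_sharp`** ∕ **`nsq_sub_PiS_le_inBlock`**:
   `nsq (f − Π′ f) ≤ ((n−1)/(2n)) · Σ_ν Σ_y Σ_{j : j_ν + 1 < n} ‖(∂_ν f)(n·y + j)‖²  ≤ ½ · (the same sum)`,
   `∂_ν = n(S_ν − 1)` (`B5Action121.sdiff … (n : ℂ)`), the inner sum running EXACTLY over the bonds `(x, x + e_ν)`, `x = n·y + j`,
   whose two ends lie in the block `B(y)` (`ScalarBlockTrialFunction.bpt_add_unitVec_of_lt`) — the base-point form of leaf UB⁺'s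
   in-block binder `hw` (`VariationalCovariantUpperBound.blockSpin_covariant_le`);
 * §3 two read-outs: `nsq_sub_PiS_le_inBlock_blockOf` (the same with the in-block predicate phrased `blockOf (x + e_ν) = blockOf x`,
   cf. `VariationalCovariantUpperBound.inBlock_of_blockOf`) and `nsq_sub_PiS_le_half` — the GLOBAL inequality of row B4.c with its
   constant `4d` replaced by `½` (drop the in-block restriction).

All constants OURS and elementary; no smallness, no background, every torus `Π_μ ℤ/(n·M_μ)`, every `n ≥ 1`, every `d`.

HONEST FRAMING (T4-DAG p. 1).  [folklore] lattice calculus about the cell's typed `U = 1` objects (`QsOp`, `PiS`, `sdiff`, `bpt`);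
nothing printed is a hypothesis or a conclusion; a SUPPLIER input of road P2's local re-run (O6)(b)–(d) (the owner's), NOT that
re-run, NOT NE2: NE2 (U1a) is NOT proved on either road; spine PROVED 0/9 unchanged; rung (B)+1 finite T⁴ — NOT infinite volume,
NOT mass gap, NOT Clay, NOT summit progress.  HONEST DEPENDENCY: continuum YM on T⁴ ⇐ BetaPertH ∧ nine spine estimates (0/9
proved); BetaPertH ⇐ (D1) ∧ (D4) ∧ CAP+tail; G-an2-4 gates asym, D1 and NE2/3/4.  ABSOLUTE RULE kept: no `def … : Prop` fact, no
cited hypothesis, zero `sorry`.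
-/

noncomputable section

open scoped BigOperators ComplexConjugate Matrix
open Finset

namespace Summit.QuantumFields.BalabanUV.T4Continuum.ScalarBlockPoincareLocal

open Literature.MathematicalPhysics.QuantumFieldTheory.Balaban1983to89.B5Prop11Plancherel (Tor fine unitVec)
open Literature.MathematicalPhysics.QuantumFieldTheory.Balaban1983to89.B5Prop11Lower (nsq nsq_nonneg)
open Literature.MathematicalPhysics.QuantumFieldTheory.Balaban1983to89.B5Action121 (sdiff sdiff_mulVec)
open Literature.MathematicalPhysics.QuantumFieldTheory.Balaban1983to89.B5Block118 (bpt QsOp QsOp_mulVec)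
open Literature.MathematicalPhysics.QuantumFieldTheory.Balaban1983to89.B5Blocks16 (blockOf blockOf_bpt)
open Literature.MathematicalPhysics.QuantumFieldTheory.Balaban1983to89.B5AverageCurlStokes (sum_blocks_real)
open Literature.MathematicalPhysics.QuantumFieldTheory.Balaban1983to89.Beta.BlockPoincare (avg)
open Literature.MathematicalPhysics.QuantumFieldTheory.Balaban1983to89.Beta.CoordCubePoincare (stepUp poincare_coordCube)
open Summit.QuantumFields.BalabanUV.T4Continuum.ScalarBlockPoincare (PiS PiS_mulVec)
open Summit.QuantumFields.BalabanUV.T4Continuum.ScalarBlockTrialFunction (bpt_add_unitVec_of_lt)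

variable {d : ℕ}

/-! ## §1 The coordinate-cube Poincaré inequality for complex-valued functions -/

/-- **THE DISCRETE POINCARÉ INEQUALITY ON THE COORDINATE CUBE, COMPLEX VALUES**: for every `n d` and every
`F : (Fin d → Fin (n+1)) → ℂ`, `Σ_y ‖F y − (Σ F)/|cube|‖² ≤ (n(n+1)/2)·Σ_μ Σ_{y : y μ ≠ last} ‖F (y + e_μ) − F y‖²` — the real
kernel result `Beta.CoordCubePoincare.poincare_coordCube` on `re ∘ F` and `im ∘ F`; the constant does NOT depend on `d`. [folklore] -/
theorem sum_norm_sub_mean_sq_le_cube (n d : ℕ) (F : (Fin d → Fin (n + 1)) → ℂ) :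
    ∑ y, ‖F y - (∑ y, F y) / (Fintype.card (Fin d → Fin (n + 1)) : ℂ)‖ ^ 2
      ≤ (n : ℝ) * (n + 1) / 2 * ∑ μ : Fin d, ∑ y ∈ univ.filter (fun y : Fin d → Fin (n + 1) => y μ ≠ Fin.last n),
          ‖F (stepUp y μ) - F y‖ ^ 2 := by
  -- `‖z‖² = (re z)² + (im z)²` (the tree's `Literature.Probability.Process.norm_sq_eq_re_sq_add_im_sq`, kept local to this import cone)
  have nsq_ri : ∀ z : ℂ, ‖z‖ ^ 2 = z.re ^ 2 + z.im ^ 2 := fun z => by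
    rw [← Complex.normSq_eq_norm_sq, Complex.normSq_apply]; ring
  set m : ℂ := (∑ y, F y) / (Fintype.card (Fin d → Fin (n + 1)) : ℂ) with hm
  have hre : m.re = avg univ (fun y => (F y).re) := by
    unfold avg; rw [hm, Complex.div_natCast_re, Complex.re_sum, Finset.card_univ]
  have him : m.im = avg univ (fun y => (F y).im) := by
    unfold avg; rw [hm, Complex.div_natCast_im, Complex.im_sum, Finset.card_univ]
  have h1 := poincare_coordCube n d (fun y => (F y).re)
  have h2 := poincare_coordCube n d (fun y => (F y).im)
  have lhs : ∑ y, ‖F y - m‖ ^ 2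
      = ∑ y, ((F y).re - avg univ (fun y => (F y).re)) ^ 2 + ∑ y, ((F y).im - avg univ (fun y => (F y).im)) ^ 2 := by
    rw [← sum_add_distrib]
    refine sum_congr rfl fun y _ => ?_
    rw [nsq_ri, Complex.sub_re, Complex.sub_im, hre, him]
  have rhs : ∀ μ : Fin d,
      ∑ y ∈ univ.filter (fun y : Fin d → Fin (n + 1) => y μ ≠ Fin.last n), ‖F (stepUp y μ) - F y‖ ^ 2
        = ∑ y ∈ univ.filter (fun y : Fin d → Fin (n + 1) => y μ ≠ Fin.last n), ((F (stepUp y μ)).re - (F y).re) ^ 2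
          + ∑ y ∈ univ.filter (fun y : Fin d → Fin (n + 1) => y μ ≠ Fin.last n), ((F (stepUp y μ)).im - (F y).im) ^ 2 := by
    intro μ
    rw [← sum_add_distrib]
    refine sum_congr rfl fun y _ => ?_
    rw [nsq_ri, Complex.sub_re, Complex.sub_im]
  rw [lhs, sum_congr rfl fun μ _ => rhs μ, sum_add_distrib, mul_add]
  exact add_le_add h1 h2

/-! ## §2 The torus instance: block by block along the digit chart `x = n·y + j` -/

section Torus

variable (n : ℕ) [NeZero n] (M : Fin d → ℕ) [hM : ∀ μ, NeZero (M μ)]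

/-- block decomposition: `nsq (f − Π′f) = Σ_y Σ_j ‖f(n·y + j) − (Q′f)(y)‖²`. [folklore] -/
theorem nsq_sub_PiS_eq_sum_blocks (f : Tor (fine n M) → ℂ) :
    nsq (f - PiS n M *ᵥ f) = ∑ y : Tor M, ∑ j : Fin d → Fin n, ‖f (bpt n M y j) - (QsOp n M *ᵥ f) y‖ ^ 2 := by
  unfold nsq
  rw [sum_blocks_real n M (fun x => ‖(f - PiS n M *ᵥ f) x‖ ^ 2)]
  refine sum_congr rfl fun y _ => sum_congr rfl fun j _ => ?_
  rw [Pi.sub_apply, PiS_mulVec, blockOf_bpt]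

/-- the block mean IS the cube mean of the chart values: `(Q′f)(y) = (Σ_j f(n·y + j))/n^d`. [folklore] -/
theorem QsOp_mulVec_eq_mean (f : Tor (fine n M) → ℂ) (y : Tor M) :
    (QsOp n M *ᵥ f) y = (∑ j : Fin d → Fin n, f (bpt n M y j)) / (Fintype.card (Fin d → Fin n) : ℂ) := by
  rw [QsOp_mulVec, Fintype.card_fun, Fintype.card_fin, Fintype.card_fin, Nat.cast_pow, one_div, inv_mul_eq_div]

/-- **THE PER-BLOCK INEQUALITY**: `Σ_j ‖f(n·y + j) − (Q′f)(y)‖² ≤ ((n−1)/(2n))·Σ_ν Σ_{j : j_ν + 1 < n} ‖(∂_ν f)(n·y + j)‖²` — only the bonds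
`(n·y + j, n·y + j + e_ν)` with BOTH ends in the block `B(y)` are charged. [folklore] -/
theorem sum_block_norm_sub_mean_sq_le (f : Tor (fine n M) → ℂ) (y : Tor M) :
    ∑ j : Fin d → Fin n, ‖f (bpt n M y j) - (QsOp n M *ᵥ f) y‖ ^ 2
      ≤ ((n : ℝ) - 1) / (2 * n) * ∑ ν : Fin d, ∑ j ∈ univ.filter (fun j : Fin d → Fin n => (j ν : ℕ) + 1 < n),
          ‖(sdiff (fine n M) (n : ℂ) ν *ᵥ f) (bpt n M y j)‖ ^ 2 := by
  obtain ⟨n', rfl⟩ : ∃ n', n = n' + 1 := ⟨n - 1, (Nat.succ_pred_eq_of_ne_zero (NeZero.ne n)).symm⟩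
  set F : (Fin d → Fin (n' + 1)) → ℂ := fun j => f (bpt (n' + 1) M y j) with hF
  have h := sum_norm_sub_mean_sq_le_cube n' d F
  rw [← QsOp_mulVec_eq_mean (n' + 1) M f y] at h
  have hn0 : (0 : ℝ) < (n' : ℝ) + 1 := by positivity
  -- the bonds of the cube ARE the in-block lattice bonds, and `F (y + e_ν) − F y = (∂_ν f)(n·y + j)/n`
  have hb : ∀ ν : Fin d,
      ∑ j ∈ univ.filter (fun j : Fin d → Fin (n' + 1) => j ν ≠ Fin.last n'), ‖F (stepUp j ν) - F j‖ ^ 2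
        = (((n' : ℝ) + 1) ^ 2)⁻¹ * ∑ j ∈ univ.filter (fun j : Fin d → Fin (n' + 1) => (j ν : ℕ) + 1 < n' + 1),
            ‖(sdiff (fine (n' + 1) M) ((n' + 1 : ℕ) : ℂ) ν *ᵥ f) (bpt (n' + 1) M y j)‖ ^ 2 := by
    intro ν
    have hfilt : univ.filter (fun j : Fin d → Fin (n' + 1) => j ν ≠ Fin.last n')
        = univ.filter (fun j : Fin d → Fin (n' + 1) => (j ν : ℕ) + 1 < n' + 1) := by
      ext j
      simp only [mem_filter, mem_univ, true_and, ← Fin.lt_last_iff_ne_last, Fin.lt_def, Fin.val_last]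
      omega
    rw [hfilt, mul_sum]
    refine sum_congr rfl fun j hj => ?_
    have hj' : (j ν : ℕ) + 1 < n' + 1 := (mem_filter.mp hj).2
    have hlt : j ν < Fin.last n' := by
      rw [Fin.lt_def, Fin.val_last]; omega
    have hstep : stepUp j ν = Function.update j ν ⟨(j ν : ℕ) + 1, hj'⟩ := by
      unfold stepUp
      congr 1
      exact Fin.ext (Fin.val_add_one_of_lt hlt)
    simp only [hF]
    rw [sdiff_mulVec, bpt_add_unitVec_of_lt (n' + 1) M y j ν hj', ← hstep, norm_mul, mul_pow, Complex.norm_natCast]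
    push_cast
    field_simp
  rw [sum_congr rfl fun ν _ => hb ν, ← mul_sum, ← mul_assoc] at h
  refine h.trans (le_of_eq ?_)
  push_cast
  congr 1
  field_simp
  ring

/-- **THE IN-BLOCK POINCARÉ INEQUALITY FOR 0-FORMS, sharp form**: on every torus `Π_μ ℤ/(n·M_μ)` and for every `n ≥ 1`,
`nsq (f − Π′f) ≤ ((n−1)/(2n))·Σ_ν Σ_y Σ_{j : j_ν + 1 < n} ‖(∂_ν f)(n·y + j)‖²` (`∂_ν = n(S_ν − 1)`, `Π′ = n^d·Q′ᴴQ′`): the block-mean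
defect is controlled by the bonds INSIDE the blocks alone, with a constant free of `d`, of the torus and of `n`. [folklore] -/
theorem nsq_sub_PiS_le_inBlock_sharp (f : Tor (fine n M) → ℂ) :
    nsq (f - PiS n M *ᵥ f)
      ≤ ((n : ℝ) - 1) / (2 * n) * ∑ ν : Fin d, ∑ y : Tor M, ∑ j ∈ univ.filter (fun j : Fin d → Fin n => (j ν : ℕ) + 1 < n),
          ‖(sdiff (fine n M) (n : ℂ) ν *ᵥ f) (bpt n M y j)‖ ^ 2 := by
  rw [nsq_sub_PiS_eq_sum_blocks]
  refine (sum_le_sum fun y _ => sum_block_norm_sub_mean_sq_le n M f y).trans (le_of_eq ?_)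
  rw [← mul_sum, sum_comm]

/-- **THE IN-BLOCK POINCARÉ INEQUALITY FOR 0-FORMS** (road P2 item (O6)(a), the shape the owner asked for, constant `½` in place of
`d/2`): `nsq (f − Π′f) ≤ ½·Σ_ν Σ_y Σ_{j : j_ν + 1 < n} ‖(∂_ν f)(n·y + j)‖²`. [folklore] -/
theorem nsq_sub_PiS_le_inBlock (f : Tor (fine n M) → ℂ) :
    nsq (f - PiS n M *ᵥ f)
      ≤ 1 / 2 * ∑ ν : Fin d, ∑ y : Tor M, ∑ j ∈ univ.filter (fun j : Fin d → Fin n => (j ν : ℕ) + 1 < n),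
          ‖(sdiff (fine n M) (n : ℂ) ν *ᵥ f) (bpt n M y j)‖ ^ 2 := by
  have hn : (0 : ℝ) < n := by exact_mod_cast Nat.pos_of_ne_zero (NeZero.ne n)
  refine (nsq_sub_PiS_le_inBlock_sharp n M f).trans (mul_le_mul_of_nonneg_right ?_ ?_)
  · rw [div_le_div_iff₀ (by positivity) (by norm_num)]; linarith
  · exact sum_nonneg fun _ _ => sum_nonneg fun _ _ => sum_nonneg fun _ _ => by positivity

/-! ## §3 Read-outs: the `blockOf` phrasing and the global inequality with constant `½` -/

/-- an in-block bond in base-point form has both ends in one block: `blockOf (n·y + j + e_ν) = blockOf (n·y + j) (= y)` for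
`j_ν + 1 < n`. [folklore] -/
theorem blockOf_bpt_add_unitVec (y : Tor M) (j : Fin d → Fin n) (ν : Fin d) (h : (j ν : ℕ) + 1 < n) :
    blockOf n M (bpt n M y j + unitVec (fine n M) ν) = blockOf n M (bpt n M y j) := by
  rw [bpt_add_unitVec_of_lt n M y j ν h, blockOf_bpt, blockOf_bpt]

/-- **`blockOf` form**: `nsq (f − Π′f) ≤ ½·Σ_ν Σ_{x : blockOf (x + e_ν) = blockOf x} ‖(∂_ν f)(x)‖²` (the predicate of
`VariationalCovariantUpperBound.inBlock_of_blockOf`; on a torus direction with `M_ν = 1` it also admits the wrap-around bond of each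
block, which only adds a non-negative term). [folklore] -/
theorem nsq_sub_PiS_le_inBlock_blockOf (f : Tor (fine n M) → ℂ) :
    nsq (f - PiS n M *ᵥ f)
      ≤ 1 / 2 * ∑ ν : Fin d, ∑ x ∈ univ.filter (fun x : Tor (fine n M) => blockOf n M (x + unitVec (fine n M) ν) = blockOf n M x),
          ‖(sdiff (fine n M) (n : ℂ) ν *ᵥ f) x‖ ^ 2 := by
  refine (nsq_sub_PiS_le_inBlock n M f).trans (mul_le_mul_of_nonneg_left (sum_le_sum fun ν _ => ?_) (by norm_num))
  rw [sum_filter, sum_blocks_real n M (fun x => if blockOf n M (x + unitVec (fine n M) ν) = blockOf n M x then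
    ‖(sdiff (fine n M) (n : ℂ) ν *ᵥ f) x‖ ^ 2 else 0)]
  refine sum_le_sum fun y _ => ?_
  rw [sum_filter]
  refine sum_le_sum fun j _ => ?_
  by_cases h : (j ν : ℕ) + 1 < n
  · rw [if_pos h, if_pos (blockOf_bpt_add_unitVec n M y j ν h)]
  · rw [if_neg h]; positivity

/-- **the GLOBAL inequality of row B4.c with constant `½`**: `nsq (f − Π′f) ≤ ½·Σ_ν nsq (∂_ν f)` (`ScalarBlockPoincare.nsq_sub_PiS_le`
had `4d`). [folklore] -/
theorem nsq_sub_PiS_le_half (f : Tor (fine n M) → ℂ) :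
    nsq (f - PiS n M *ᵥ f) ≤ 1 / 2 * ∑ ν : Fin d, nsq (sdiff (fine n M) (n : ℂ) ν *ᵥ f) := by
  refine (nsq_sub_PiS_le_inBlock n M f).trans (mul_le_mul_of_nonneg_left (sum_le_sum fun ν _ => ?_) (by norm_num))
  unfold nsq
  rw [sum_blocks_real n M (fun x => ‖(sdiff (fine n M) (n : ℂ) ν *ᵥ f) x‖ ^ 2)]
  refine sum_le_sum fun y _ => ?_
  exact sum_le_sum_of_subset_of_nonneg (filter_subset _ _) fun j _ _ => by positivity

end Torus

end Summit.QuantumFields.BalabanUV.T4Continuum.ScalarBlockPoincareLocal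

end
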